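import Mathlib.Analysis.Complex.Liouville
import Literature.NumberTheory.Transcendental.PhilipponZeroEstimateOrder
import HarnessLib

/-!
# The linear subgroup theorem on `𝔾ₐ × 𝔾ₘ^N` (Waldschmidt 1988, Thm 4.1), II: smallness of the jets along `W`

Topic `Literature/NumberTheory/Transcendental`; second file of the direct proof of
[Waldschmidt1988, Thm 4.1] for `G = 𝔾ₐ × 𝔾ₘ^m` (see `LinearSubgroupGaGmAuxiliary.lean` for the
plan). The auxiliary function `F_P(v) = P(g · exp_G v)` is made small on a ball of the subspace
`V ⊆ Lie G` (part I); Philippon's zero estimate (`Philippon1986_GaGm`, in the dictionary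
`GaGm.vanishesToOrder_iff_wordDeriv` of `PhilipponZeroEstimateOrder.lean`) wants the vanishing at
the points `g · exp_G y`, `y ∈ Y ⊆ V`, of the values `(D_{u₀} ⋯ D_{u_{k-1}} P)(g · exp_G y)` of all
WORDS of invariant derivations with letters `uᵢ` in `W ⊆ V`. Here we bound these values by the
supremum of `F_P` on the ball (the arithmetic — they are algebraic numbers — is part III):

* `norm_evalAt_invDeriv_le` — ONE letter: `(D_e Q)(g · exp_G y) = d/dξ Q(g · exp_G(y + ξe))|₀`
  (`GaGm.iteratedDeriv_evalAt_mul_exp_line`), so Cauchy's inequality on the circle `|ξ| = r`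
  (`Complex.norm_deriv_le_of_forall_mem_sphere_norm_le`) gives
  `‖(D_e Q)(g exp y)‖ ≤ B / r` if `‖Q(g exp v)‖ ≤ B` for `v ∈ V`, `‖v‖ ≤ ‖y‖ + r‖e‖`;
* `norm_evalAt_wordDeriv_le` — words of length `j` (induction, shrinking the ball by `r‖e‖` at
  each letter, `GaGm.wordDeriv_cons`): `‖(D_{u₀}⋯D_{u_{j-1}}P)(g exp y)‖ ≤ B / r^j` whenever
  `‖P(g exp v)‖ ≤ B` on `{v ∈ V ; ‖v‖ ≤ R'}`, `uᵢ ∈ V`, `‖uᵢ‖ ≤ E`, `y ∈ V`, `‖y‖ + j r E ≤ R'`.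

This is the several-variable Cauchy inequality in the only form the method needs (no polydiscs:
all differentiations are along complex LINES inside `V`). Everything here is PROVED; no
definitions, no named facts.

## References

* [Waldschmidt1988] M. Waldschmidt, *On the transcendence methods of Gel'fond and Schneider in
  several variables*, New Advances in Transcendence Theory (A. Baker ed.), CUP 1988, 375–398, §6
  ("the estimates for the derivatives are provided by Lemma 7 of D. Bertrand …", p. 389).
* Yu. V. Nesterenko, P. Philippon (eds.), *Introduction to Algebraic Independence Theory*, LNM 1752
  (2001), Ch. 11 (D. Roy), Lemma 3.3 (jets along `W` = values of invariant derivations).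
-/

noncomputable section

open Complex Metric

namespace Literature.NumberTheory.Transcendental.LinearSubgroupGaGm

open GaGm

variable {m : ℕ}

/-- The restriction of `v ↦ Q(g · exp_G v)` to a complex line is entire. [folklore] -/
theorem differentiable_evalAt_mul_exp_line (Q : MvPolynomial (Fin (m + 1)) ℂ) (g : GaGm m)
    (y e : ℂ × (Fin m → ℂ)) :
    Differentiable ℂ fun ξ : ℂ => evalAt Q (g * exp (y + ξ • e)) := by
  have h1 : ContDiff ℂ 1 fun v : ℂ × (Fin m → ℂ) => evalAt Q (g * exp v) :=
    contDiff_evalAt_mul_exp Q g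
  have h2 : ContDiff ℂ 1 fun ξ : ℂ => y + ξ • e :=
    contDiff_const.add (contDiff_id.smul contDiff_const)
  exact (h1.comp h2).differentiable one_ne_zero

/-- **One letter** (Cauchy's inequality along the line `y + ℂe`): if `‖Q(g · exp_G v)‖ ≤ B` for all
`v ∈ V` with `‖v‖ ≤ ‖y‖ + r‖e‖` (`r > 0`, `y, e ∈ V`), then `‖(D_e Q)(g · exp_G y)‖ ≤ B / r`.
[folklore] -/
theorem norm_evalAt_invDeriv_le (Q : MvPolynomial (Fin (m + 1)) ℂ) (g : GaGm m)
    (V : Submodule ℂ (ℂ × (Fin m → ℂ))) {y e : ℂ × (Fin m → ℂ)} (hy : y ∈ V) (he : e ∈ V)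
    {r B : ℝ} (hr : 0 < r)
    (hB : ∀ v ∈ V, ‖v‖ ≤ ‖y‖ + r * ‖e‖ → ‖evalAt Q (g * exp v)‖ ≤ B) :
    ‖evalAt (invDeriv e Q) (g * exp y)‖ ≤ B / r := by
  have hderiv : deriv (fun ξ : ℂ => evalAt Q (g * exp (y + ξ • e))) 0 =
      evalAt (invDeriv e Q) (g * exp y) := by
    have h := iteratedDeriv_evalAt_mul_exp_line Q g y e 1
    rwa [iteratedDeriv_one, Function.iterate_one] at h
  rw [← hderiv]
  refine Complex.norm_deriv_le_of_forall_mem_sphere_norm_le hr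
    (differentiable_evalAt_mul_exp_line Q g y e).diffContOnCl fun ξ hξ => ?_
  refine hB _ (V.add_mem hy (V.smul_mem ξ he)) ?_
  rw [mem_sphere, dist_zero_right] at hξ
  calc ‖y + ξ • e‖ ≤ ‖y‖ + ‖ξ • e‖ := norm_add_le _ _
    _ = ‖y‖ + r * ‖e‖ := by rw [norm_smul, hξ]

/-- **Words** (iterated Cauchy inequalities with shrinking balls): if `‖P(g · exp_G v)‖ ≤ B` for
all `v ∈ V` with `‖v‖ ≤ R'`, the letters `u₀, …, u_{j-1}` lie in `V` with `‖uᵢ‖ ≤ E`, and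
`y ∈ V` with `‖y‖ + j·rE ≤ R'` (`r > 0`), then
`‖(D_{u₀} ⋯ D_{u_{j-1}} P)(g · exp_G y)‖ ≤ B / r^j`. [folklore] -/
theorem norm_evalAt_wordDeriv_le (P : MvPolynomial (Fin (m + 1)) ℂ) (g : GaGm m)
    (V : Submodule ℂ (ℂ × (Fin m → ℂ))) {R' B E r : ℝ} (hr : 0 < r)
    (hB : ∀ v ∈ V, ‖v‖ ≤ R' → ‖evalAt P (g * exp v)‖ ≤ B) :
    ∀ {j : ℕ} (u : Fin j → ℂ × (Fin m → ℂ)), (∀ i, u i ∈ V) → (∀ i, ‖u i‖ ≤ E) →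
      ∀ y ∈ V, ‖y‖ + j * (r * E) ≤ R' → ‖evalAt (wordDeriv u P) (g * exp y)‖ ≤ B / r ^ j := by
  intro j
  induction j with
  | zero =>
    intro u _ _ y hy hyR
    rw [wordDeriv_zero, pow_zero, div_one]
    exact hB y hy (by simpa using hyR)
  | succ j ih =>
    intro u huV huE y hy hyR
    rw [← Fin.cons_self_tail u, wordDeriv_cons, pow_succ, ← div_div]
    refine norm_evalAt_invDeriv_le _ g V hy (huV 0) hr fun v hv hvR => ?_
    refine ih (Fin.tail u) (fun i => huV _) (fun i => huE _) v hv ?_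
    have h1 : r * ‖u 0‖ ≤ r * E := mul_le_mul_of_nonneg_left (huE 0) hr.le
    have h2 : ‖y‖ + ((j + 1 : ℕ) : ℝ) * (r * E) = ‖y‖ + r * E + j * (r * E) := by
      push_cast; ring
    linarith

end Literature.NumberTheory.Transcendental.LinearSubgroupGaGm

end
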